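import Summits.ABC.IUTFork.PilotSlotResidueTwoValued
import Summits.ABC.IUTFork.LDHNonsplitLocusHullRegime
import Summits.ABC.IUTFork.LDHGenuinePerImageBroberg
import Summits.ABC.IUTFork.BrobergSzpiroBad
import Literature.IUT.LogVolume.WeightDescentExpectation
import Literature.IUT.LogVolume.PilotSlotResidueSupport
import HarnessLib

/-!
# The (Ind1) slot residue of EVERY genuine Θ-volume datum at Broberg's quadratic point `λ = (8−3√7)²(5−2√7)/(4−3√7)⁴ ∈ ℚ(√7)`, EXACTLY:
# `slotResidue(T) = (11·log 3 + 4·log 47)/l · (1/ℓ⋆)·Σ_{i<ℓ⋆} (i+1)²·(½ − 2^{−(i+2)})` (`l` prime, `l ∉ {3, 47}`)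

Record-only PROOF file (D-0012; 0 def / 0 `Prop` fact / 0 instance / 0 notation) of the abc-iut cell (seat abc-iut-c312-d1, gen 12;
rows «C:PLACES-TRANSPORT-DMOD» → «C:UNION-PRINT-ISM-BROBERG» of RULING (α), C LEAD abc-iut-plan g12). TAKES NO SIDE on [IUTchIII] Cor. 3.12.

Every datum-level residue theorem of the tree is phrased over the ABSTRACT places of the datum's field of moduli `F_mod(E_F) = ℚ(j(E_F)) ⊆ F`
(`PilotData.slotResidue`, abc-iut-S8). At Broberg's point `P = (ℚ(√7), λ)` (abc-iut-W-row-2's `Broberg.point`; `d_mod = 2 = [F_tpd:ℚ]`, abc-iut-C-cert-2's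
`Broberg.dmod_eq_two`; bad places off `2`: `𝔭₃, 𝔭₃', 𝔭₄₇` with `ord j(λ) = −2, −24, −8`, `BrobergPoint.lean`) this file computes the residue of
the pilot data of EVERY genuine Θ-volume datum `T : ThetaVolumeDatumAt Broberg.point l` WITHOUT a field isomorphism, by the S-chain's WEIGHT
DESCENT THROUGH THE PLACES OF `F` (abc-iut-S2's tuple form `sum_prod_weight_mul_eq_of_fibreConst`, `WeightDescentExpectation.lean`; abc-iut-s2-p5's
«same image ⟹ same fibres, weights, normalised local heights», `AbcOfSHvolSplitHeight.lean`; abc-iut-s2-p1's badness transport read on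
`F_tpd = ℚ(√7)` directly, `PointDict.under_mem_badPrimesMod_iff`):

* §1 (the point's field `K = ℚ(√7)`): `Broberg.half_le_weight` (`Pr(W) = n_W/2 ≥ ½` for every place), `weight_𝔭₃ / _𝔭₃' / _𝔭₄₇ = ½`,
  `localDegree_𝔭₃ / … = 1`, `eq_𝔭₃_or_𝔭₃'_of_mem_placesOver_three` (the places over `3` are `𝔭₃, 𝔭₃'`), the normalised (P5)-bad heights
  `h_l(W) := [W ∈ 𝕍^bad, W ∤ 2l]·(−ord_W j(λ))·ln N(W)/(2l·n_W)` at `𝔭₃, 𝔭₃', 𝔭₄₇` (`log 3/l`, `12·log 3/l`, `4·log 47/l`) and `0` elsewhere over `47`;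
  the two-valued collection sums over `V(K)_3` and `V(K)_47` (this lineage's `sum_last_sub_inf_mul_prod_weight_eq_of_twoValued`);
* §2 (transport): for every datum `T` at `(Broberg.point, l)`, `l ∉ {2, 3, 47}`: `range(ℚ(√7) → F) = range(F_mod(E_F) → F)` (abc-iut-s2-p5
  `range_algebraMap_adjoin_jInv_eq` + `ℚ(j(λ)) = ℚ(√7)`); pointwise through a place `x` of `F`: the datum's normalised `q`-height
  `μ_T(x ∩ F_mod) = h_l(x ∩ ℚ(√7))` (abc-iut-S7 `PointDict.mu_eq`, `under_mem_badPrimesMod_iff`, `ord_mul_logNorm_div_localDegree_finBelow_eq`); hence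
  EVERY collection sum of the residue descends to `F` and re-ascends to `ℚ(√7)`: **`Broberg.slotResidue_singleton_three_eq`**,
  **`Broberg.slotResidue_singleton_fortySeven_eq`**, and, by abc-iut-S8's support canonicity `slotResidue_eq_of_support`,
  **`Broberg.slotResidue_eq`** — `slotResidue(T.I.X, T(I)) = (11·log 3 + 4·log 47)/l · (1/ℓ⋆)·Σ_{i<ℓ⋆} (i+1)²·(½ − (½)^{i+2})`.

HONEST SCOPE: classical bookkeeping about OUR typed data at a known abc triple over `ℚ(√7)`; non-emptiness of the datum types is NOT used or
claimed here (abc-iut-W-row-2 proved it at `l = 7, 11`); nothing here bears on [IUTchIII] Cor. 3.12 or asserts abc; no side taken.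
[cite: Mochizuki2012, IUTchIV Thm. 1.10 Step (v) p. 27–28; Cor. 2.2 (ii) proof (P5) p. 46] [cite: DupuyHilado2025, §3.3, §3.6, §4.7]
[cite: NeukirchANT1999, Ch. I §8 Prop. (8.2)] [claim: Mochizuki2012, status: disputed] for every IUT quotation.
-/

noncomputable section

open scoped Classical NumberField

open NumberField IsDedekindDomain

namespace Summit.ABC.IUTFork.Broberg

open Sqrt7 Literature.IUT.LogVolume Literature.IUT.LogVolume.Cor22 Literature.IUT.HodgeTheaters
  Literature.NumberTheory.DiophantineGeometry.GenEll

/-! ## §1. The point's field `K = ℚ(√7)`: weights, the places over `3`, the normalised bad heights -/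

/-- **Every place of `ℚ(√7)` has probability weight `≥ ½`** (`Pr(W) = n_W/[K:ℚ] = n_W/2`, `n_W ≥ 1`). [cite: DupuyHilado2025, §3.6] -/
theorem half_le_weight (W : HeightOneSpectrum (𝓞 point.F)) : (1 : ℝ) / 2 ≤ weight point.F W := by
  unfold weight
  rw [show Module.finrank ℚ point.F = 2 from finrank_eq_two]
  have h1 : (1 : ℝ) ≤ localDegree point.F W := by exact_mod_cast localDegree_pos point.F W
  push_cast
  linarith

/-- **Two distinct places over one prime each weigh `½`, and there is no third** (weights `≥ ½` summing to `1` over `V(K)_p`). [cite: DupuyHilado2025, §3.6] -/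
theorem weight_eq_half_of_two {p : ℕ} [Fact p.Prime] {V V' : HeightOneSpectrum (𝓞 point.F)} (hV : V ∈ placesOver point.F p)
    (hV' : V' ∈ placesOver point.F p) (hne : V ≠ V') :
    weight point.F V = 1 / 2 ∧ weight point.F V' = 1 / 2 ∧ ∀ W ∈ placesOver point.F p, W = V ∨ W = V' := by
  have hsum := PilotData.sum_weight_placesOver (F := point.F) p
  -- split the sum at `V` and `V'`
  have hsum' : ∑ W ∈ placesOver point.F p, weight point.F W = 1 := by
    rw [← hsum, ← Finset.sum_coe_sort (placesOver point.F p)]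
  have hV'e : V' ∈ (placesOver point.F p).erase V := Finset.mem_erase.mpr ⟨hne.symm, hV'⟩
  rw [← Finset.add_sum_erase _ _ hV, ← Finset.add_sum_erase _ _ hV'e] at hsum'
  have hrest : 0 ≤ ∑ W ∈ ((placesOver point.F p).erase V).erase V', weight point.F W :=
    Finset.sum_nonneg fun W _ => weight_nonneg point.F W
  have h1 := half_le_weight V
  have h2 := half_le_weight V'
  refine ⟨by linarith, by linarith, fun W hW => ?_⟩
  by_contra hW'
  push Not at hW'
  have hWe : W ∈ ((placesOver point.F p).erase V).erase V' :=
    Finset.mem_erase.mpr ⟨hW'.2, Finset.mem_erase.mpr ⟨hW'.1, hW⟩⟩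
  have h3 : weight point.F W ≤ ∑ W ∈ ((placesOver point.F p).erase V).erase V', weight point.F W :=
    Finset.single_le_sum (fun W _ => weight_nonneg point.F W) hWe
  have h4 := half_le_weight W
  linarith

/-- **`Pr(𝔭₃) = Pr(𝔭₃') = ½`, and `V(K)_3 = {𝔭₃, 𝔭₃'}`** (places passed as `V = 𝔭₃`, `V' = 𝔭₃'` over the point's own instances, as in
abc-iut-C-cert-2's `logNorm_𝔭₃`). [cite: DupuyHilado2025, §3.6] [cite: NeukirchANT1999, Ch. I §8] -/
theorem weight_three [Fact (Nat.Prime 3)] (V V' : HeightOneSpectrum (𝓞 point.F)) (hV : V = 𝔭₃) (hV' : V' = 𝔭₃') :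
    weight point.F V = 1 / 2 ∧ weight point.F V' = 1 / 2 ∧ ∀ W ∈ placesOver point.F 3, W = V ∨ W = V' :=
  weight_eq_half_of_two (mem_placesOver_of_natCast_mem 3 V (by rw [hV]; exact_mod_cast three_mem_𝔭₃))
    (mem_placesOver_of_natCast_mem 3 V' (by rw [hV']; exact_mod_cast three_mem_𝔭₃')) (by rw [hV, hV']; exact 𝔭₃_ne_𝔭₃')

/-- **`Pr(𝔭₄₇) = Pr(𝔭₄₇') = ½`, and `V(K)_{47} = {𝔭₄₇, 𝔭₄₇'}`.** [cite: DupuyHilado2025, §3.6] [cite: NeukirchANT1999, Ch. I §8] -/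
theorem weight_fortySeven [Fact (Nat.Prime 47)] (V V' : HeightOneSpectrum (𝓞 point.F)) (hV : V = 𝔭₄₇) (hV' : V' = 𝔭₄₇') :
    weight point.F V = 1 / 2 ∧ weight point.F V' = 1 / 2 ∧ ∀ W ∈ placesOver point.F 47, W = V ∨ W = V' :=
  weight_eq_half_of_two (mem_placesOver_of_natCast_mem 47 V (by rw [hV]; exact_mod_cast fortySeven_mem_𝔭₄₇))
    (mem_placesOver_of_natCast_mem 47 V' (by rw [hV']; exact_mod_cast fortySeven_mem_𝔭₄₇')) (by rw [hV, hV']; exact 𝔭₄₇_ne_𝔭₄₇')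

/-- A place of weight `½` has local degree `n_W = 1`. [cite: DupuyHilado2025, §3.6] -/
theorem localDegree_eq_one_of_weight {W : HeightOneSpectrum (𝓞 point.F)} (h : weight point.F W = 1 / 2) :
    (localDegree point.F W : ℝ) = 1 := by
  unfold weight at h
  rw [show Module.finrank ℚ point.F = 2 from finrank_eq_two] at h
  push_cast at h
  linarith

/-- **The normalised (P5)-bad `q`-height on `ℚ(√7)` at the three poles**, for a prime `l ∉ {3, 47}`:
`h_l(𝔭₃) = log 3/l`, `h_l(𝔭₃') = 12·log 3/l`, `h_l(𝔭₄₇) = 4·log 47/l` (`h_l(W) := −(1/(2l))·ord_W j(λ)·ln N(W)/n_W` on `𝕍^bad ∖ {W | 2l}`).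
[cite: Mochizuki2012, IUTchIV Cor. 2.2 (ii) proof (P5) p. 46] [claim: Mochizuki2012, status: disputed] -/
theorem badHeight_values {l : ℕ} (hl : l.Prime) (h3 : l ≠ 3) (h47 : l ≠ 47) :
    (∀ W : HeightOneSpectrum (𝓞 point.F), W = 𝔭₃ →
      (if W ∈ badPlacesAvoid point {2, l} then
        -(1 / (2 * (l : ℝ))) * ((ord point.F W (jInv point.x) : ℝ) * logNorm point.F W / (localDegree point.F W : ℝ)) else 0) =
        Real.log 3 / l) ∧
    (∀ W : HeightOneSpectrum (𝓞 point.F), W = 𝔭₃' →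
      (if W ∈ badPlacesAvoid point {2, l} then
        -(1 / (2 * (l : ℝ))) * ((ord point.F W (jInv point.x) : ℝ) * logNorm point.F W / (localDegree point.F W : ℝ)) else 0) =
        12 * Real.log 3 / l) ∧
    (∀ W : HeightOneSpectrum (𝓞 point.F), W = 𝔭₄₇ →
      (if W ∈ badPlacesAvoid point {2, l} then
        -(1 / (2 * (l : ℝ))) * ((ord point.F W (jInv point.x) : ℝ) * logNorm point.F W / (localDegree point.F W : ℝ)) else 0) =
        4 * Real.log 47 / l) := by
  haveI : Fact (Nat.Prime 3) := ⟨Nat.prime_three⟩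
  haveI : Fact (Nat.Prime 47) := ⟨by norm_num⟩
  have hl0 : (l : ℝ) ≠ 0 := by exact_mod_cast hl.ne_zero
  have havoid := pair_avoids_of_ne hl h3 h47
  refine ⟨?_, ?_, ?_⟩
  · intro W hW
    have hmem : W ∈ badPlacesAvoid point {2, l} :=
      Finset.mem_filter.mpr ⟨hW ▸ mem_badPlaces.1, fun p hp => hW ▸ (havoid p hp).1⟩
    rw [if_pos hmem, logNorm_𝔭₃ W hW, localDegree_eq_one_of_weight (weight_three W 𝔭₃' hW rfl).1,
      show ord point.F W (jInv point.x) = -2 from hW ▸ ord_jInv_𝔭₃]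
    push_cast
    field_simp
    try ring
  · intro W hW
    have hmem : W ∈ badPlacesAvoid point {2, l} :=
      Finset.mem_filter.mpr ⟨hW ▸ mem_badPlaces.2.1, fun p hp => hW ▸ (havoid p hp).2.1⟩
    rw [if_pos hmem, logNorm_𝔭₃' W hW, localDegree_eq_one_of_weight (weight_three 𝔭₃ W rfl hW).2.1,
      show ord point.F W (jInv point.x) = -24 from hW ▸ ord_jInv_𝔭₃']
    push_cast
    field_simp
    try ring
  · intro W hW
    have hmem : W ∈ badPlacesAvoid point {2, l} :=
      Finset.mem_filter.mpr ⟨hW ▸ mem_badPlaces.2.2, fun p hp => hW ▸ (havoid p hp).2.2⟩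
    rw [if_pos hmem, logNorm_𝔭₄₇ W hW, localDegree_eq_one_of_weight (weight_fortySeven W 𝔭₄₇' hW rfl).1,
      show ord point.F W (jInv point.x) = -8 from hW ▸ ord_jInv_𝔭₄₇]
    push_cast
    field_simp
    try ring

/-- Over `47`, every place other than `𝔭₄₇` is NOT a bad place (`V(K)_{47} = {𝔭₄₇, 𝔭₄₇'}`, `𝔭₄₇' ∉ 𝕍^bad`), so `h_l = 0` there.
[cite: Mochizuki2012, IUTchIV Cor. 2.2 (i) p. 41] [claim: Mochizuki2012, status: disputed] -/
theorem badHeight_eq_zero_of_ne_𝔭₄₇ [Fact (Nat.Prime 47)] {l : ℕ} (W : HeightOneSpectrum (𝓞 point.F))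
    (hW : W ∈ placesOver point.F 47) (hne : W ≠ 𝔭₄₇) :
    (if W ∈ badPlacesAvoid point {2, l} then
        -(1 / (2 * (l : ℝ))) * ((ord point.F W (jInv point.x) : ℝ) * logNorm point.F W / (localDegree point.F W : ℝ)) else 0) = 0 := by
  have hW' : W = 𝔭₄₇' := by
    rcases (weight_fortySeven 𝔭₄₇ 𝔭₄₇' rfl rfl).2.2 W hW with h | h
    · exact absurd h hne
    · exact h
  have hnot : W ∉ badPlacesAvoid point {2, l} := fun h =>
    𝔭₄₇'_not_mem_badPlaces (hW' ▸ (Finset.mem_filter.mp h).1)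
  rw [if_neg hnot]

/-! ## §2. Transport at a genuine Θ-volume datum `T` of `(Broberg.point, l)`: `F_mod(E_F)` and `ℚ(√7)` through the places of `F` -/

/-- **`ℚ(j(λ)) = ℚ(√7)`** (`d_mod = 2 = [ℚ(√7):ℚ]`): the intermediate field `ℚ(j(λ)) ⊆ F_tpd` is all of `F_tpd`.
[cite: Mochizuki2012, IUTchIV Thm. 1.10 p. 22] [claim: Mochizuki2012, status: disputed] -/
theorem adjoin_jInv_eq_top : IntermediateField.adjoin ℚ ({jInv point.x} : Set point.F) = ⊤ := by
  apply IntermediateField.eq_of_le_of_finrank_eq le_top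
  rw [IntermediateField.finrank_top', show Module.finrank ℚ point.F = 2 from finrank_eq_two]
  exact dmod_eq_two

/-- **Same image**: for every genuine Θ-volume datum `T` at `(Broberg.point, l)` the images of `F_tpd = ℚ(√7)` and of the datum's
field of moduli `F_mod(E_F) = ℚ(j(E_F))` in `F` COINCIDE (abc-iut-s2-p5's `PointDict.range_algebraMap_adjoin_jInv_eq` + `ℚ(j(λ)) = ℚ(√7)`).
[cite: Mochizuki2012, IUTchI Def. 3.1 (b) p. 61] [claim: Mochizuki2012, status: disputed] -/
theorem range_algebraMap_eq {l : ℕ} (T : ThetaVolumeDatumAt point l) :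
    (letI := T.instFieldF; letI := T.instNumberFieldF; letI := T.instAlgebraF; letI := T.instIsElliptic
     Set.range (algebraMap point.F T.F) = Set.range (algebraMap ↥(fieldOfModuli T.E) T.F)) := by
  letI := T.instFieldF; letI := T.instNumberFieldF; letI := T.instAlgebraF; letI := T.instIsElliptic
  rw [← PointDict.range_algebraMap_adjoin_jInv_eq T]
  ext y
  simp only [Set.mem_range, RingHom.coe_comp, Function.comp_apply]
  constructor
  · rintro ⟨z, rfl⟩
    have hz : z ∈ IntermediateField.adjoin ℚ ({jInv point.x} : Set point.F) := by
      rw [adjoin_jInv_eq_top]; exact IntermediateField.mem_top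
    exact ⟨⟨z, hz⟩, rfl⟩
  · rintro ⟨z, rfl⟩
    exact ⟨(z : point.F), rfl⟩

/-- **The datum's normalised `q`-height, read on `ℚ(√7)` through a place `x` of `F`.** For a genuine Θ-volume datum `T` at
`(Broberg.point, l)` and a finite place `x` of its field `F`:
`μ_T(x ∩ F_mod(E_F)) = h_l(x ∩ ℚ(√7))`, where `μ_T(u) = P_q(u)·ln N(u)/n_u` (abc-iut-S7 `PointDict.mu_eq`: `(−ord_u j(E_F))/(2l)·ln N(u)/n_u` on
`𝕍^bad_mod`, `0` off it) and `h_l(W) = [W ∈ 𝕍^bad, W ∤ 2l]·(−1/(2l))·ord_W j(λ)·ln N(W)/n_W` (badness: abc-iut-s2-p1/`under_mem_badPrimesMod_iff`;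
value: abc-iut-s2-p5 `ord_mul_logNorm_div_localDegree_finBelow_eq`, `j(E_F) = j(λ)` in `F` by `T.j_eq`). [cite: DupuyHilado2025, §3.3, §3.6]
[cite: Mochizuki2012, IUTchIV Cor. 2.2 (ii) proof (P5) p. 46] [claim: Mochizuki2012, status: disputed] -/
theorem mu_finBelow_eq {l : ℕ} (T : ThetaVolumeDatumAt point l)
    (x : @HeightOneSpectrum (@NumberField.RingOfIntegers T.F T.instFieldF) _) :
    (letI := T.instFieldF; letI := T.instNumberFieldF; letI := T.instAlgebraF; letI := T.instFieldK
     letI := T.instNumberFieldK; letI := T.instAlgebraK; letI := T.instFieldFbar; letI := T.instAlgebraFbar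
     letI := T.instAlgebraKFbar; letI := T.instIsElliptic
     T.I.X.qPilot (finBelow ↥(fieldOfModuli T.E) T.F x) * logNorm ↥(fieldOfModuli T.E) (finBelow ↥(fieldOfModuli T.E) T.F x) /
         (localDegree ↥(fieldOfModuli T.E) (finBelow ↥(fieldOfModuli T.E) T.F x) : ℝ) =
       (if finBelow point.F T.F x ∈ badPlacesAvoid point {2, l} then
          -(1 / (2 * (l : ℝ))) * ((ord point.F (finBelow point.F T.F x) (jInv point.x) : ℝ) *
            logNorm point.F (finBelow point.F T.F x) / (localDegree point.F (finBelow point.F T.F x) : ℝ))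
        else 0)) := by
  letI := T.instFieldF; letI := T.instNumberFieldF; letI := T.instAlgebraF; letI := T.instFieldK
  letI := T.instNumberFieldK; letI := T.instAlgebraK; letI := T.instFieldFbar; letI := T.instAlgebraFbar
  letI := T.instAlgebraKFbar; letI := T.instIsElliptic
  set FE : Type := ↥(fieldOfModuli T.E) with hFE
  set u := finBelow FE T.F x with hu
  have hμ := PointDict.mu_eq T u
  have he : HeightOneSpectrum.under (𝓞 FE) x = u := HeightOneSpectrum.ext rfl
  have hbad : u ∈ ThetaData.badPrimesMod T.D ↔ finBelow point.F T.F x ∈ badPlacesAvoid point {2, l} := by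
    rw [← he]; exact PointDict.under_mem_badPrimesMod_iff T x
  have hab : algebraMap FE T.F (ThetaData.jMod T.E) = algebraMap point.F T.F (jInv point.x) := by
    rw [ThetaData.algebraMap_jMod]; exact T.j_eq
  have hval := ord_mul_logNorm_div_localDegree_finBelow_eq (A := FE) (B := point.F) (K := T.F) hab x
  rw [hμ]
  by_cases hb : u ∈ ThetaData.badPrimesMod T.D
  · rw [if_pos hb, if_pos (hbad.mp hb), ← hval]
    push_cast
    ring
  · rw [if_neg hb, if_neg (fun h => hb (hbad.mpr h))]

end Summit.ABC.IUTFork.Broberg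

end
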